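import Summits.FinalStateConjecture.FinalStateConjecture.Theses.LogTimeThreeAnnuli
import Summits.FinalStateConjecture.FinalStateConjecture.Theorems.LogTimeThreeAnnuliDyadicCaptureCaptureUpgrade

/-!
# Line `registered` (file `birth.lean`) — skeleton v7 for the crux `DyadicCapture` (stmt-FinalStateConjecture-17488)

Route `LogTimeThreeAnnuli` (route-FinalStateConjecture-LogTimeThreeAnnuli), crux #2
`Summit.FinalStateConjecture.FinalStateConjecture.Theses.LogTimeThreeAnnuli.DyadicCapture`
(`ERA(𝒟) → CONCL(𝒟)`: an HONEST SUBCONVERGENT FINAL ERA over a reference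
`QuasiFinalStateDecomposition 𝒟 O 2 ⊤` upgrades to the re-typed Statement's settling conjunct).

HISTORY. v1 (planner `birth`): windowwise summability → window freezing → rechart. Cycles 1–3 (leads c1–c3)
landed freezing (p147277 p148001 p147488 p154421), the recharts (p149044 p157784 p158712 p163672), frozen-member
uniqueness (p162064) and the CAPTURE UPGRADE (p165989 p167565 p167657 p168834: `C⁰` normalisation + the era's own
windowed closeness ⇒ labels in the window + `Cᵏ` convergence on fixed and growing slabs, no summability), and showed
that the causal horizon rigidity of the idea `exhaustion-rigidity-capture` is false in the line's model geometry
(Kerr block II, `t*` unbounded; memo `Lines/birth-horizonRigidity-status.md`). v6 (lead c3) had ONE open stub,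
`stub_normalisedEra : ERA(𝒟) → ∃ system, ERA-clauses verbatim ∧ ∀ i ρ, δ⁰_ρ(τ; d.mass i, d.spin i) → 0`, declared
crux-sized (`promote-stub`).

v7 (lead c4, 2026-08-17) — THE REDUCTION PHASE OF THIS LINE IS CLOSED BY A CERTIFICATE. The open stub is weakened
once more, to the order the composition actually consumes (`k = 2` in the flat-zone and windowed-closeness clauses of
its conclusion: `stub_normalisedEraTwo`, implied by v6's stub, `stub_normalisedEraTwo_of_v6`), and the skeleton now
PROVES, modulo the two bookkeeping stubs of this cycle's wave, that the open stub is EQUIVALENT to the crux: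
`stub_normalisedEraTwo_iff_dyadicCapture : (statement of stub_normalisedEraTwo) ↔ DyadicCapture`.
Forward (`stub_conclOfNormalisedEraTwo`): capture upgrade at order 2 chart by chart (`captureB_tendsto_fixed`,
`captureC_tendsto_growing` are per-order), sub-extremality from the window, same-parameter rechart
(`QuasiFinalStateDecomposition.toFinalStateDecomposition`) and the landed `stub_settledRechart`. Backward
(`stub_normalisedEraTwoOfConcl`): a settled `C²` decomposition IS a `C⁰`-normalised era at order 2 — the forgetful map
`FinalStateDecomposition.toQuasi`, a window around the finitely many sub-extremal labels, and the VECTOR ⇒ COVECTOR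
orientation lemma under `C⁰` closeness (reverse Cauchy–Schwarz with margin: `g(dΨ(ΛV), dΨ w) = −(Λ⁻¹w)⁰ + O(δ)`).
Hence what remains open is the crux itself, in its thinnest dress: "an honest subconvergent final era can be re-gauged
so that each near zone converges in `C⁰`, on every fixed slab, to its own reference member" (asymptotic, not merely
orbital, stability towards a sub-extremal Kerr in horizon-normalised Kerr–Schild charts) — an OPEN PROBLEM (Kerr
stability is perturbative: arXiv:2104.11857 for `|a| ≪ M`, arXiv:2606.28253 (claim) for `|a| < M`, both from Cauchy
data close to ONE Kerr in weighted norms; the era hypothesis is unweighted slab-wise closeness to a FAMILY, to which no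
printed capture theorem applies — presearch recorded in the lead's NOTES.md). `sorry` occurs ONLY in the three
`stub_*` theorems; `DyadicCapture_of` is the only theorem whose head is the crux. Disproof used: none exists
(`ledger crux ls`: no `Disproof.lean`, no `Theorems/DyadicCapture/Negative/*`).
-/

-- `Summit.<Summit>.<Problem>`: for the single-conjunct summit the duplicate component is mandated.
set_option linter.dupNamespace false
set_option linter.unusedVariables false

noncomputable section

namespace Summit.FinalStateConjecture.FinalStateConjecture.Cruxes.DyadicCapture.Birth

open Literature.Geometry.Lorentzian
open Summit.FinalStateConjecture.FinalStateConjecture.Theses.LogTimeThreeAnnuli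
open scoped Topology Manifold ENNReal ContDiff
open Filter Set

/-! ## The registered OPEN stub (v7) -/

/-- **Stub N₂ — a `C⁰`-normalised honest era, order two** (the open problem of the line = the crux, see
`stub_normalisedEraTwo_iff_dyadicCapture`). Hypothesis: verbatim the antecedent `ERA(𝒟)` of `DyadicCapture`.
Conclusion: a reference system with the era clauses verbatim EXCEPT that the flat-zone convergence and the windowed
closeness are asked at order `k = 2` only, AND `∀ i ρ, δ⁰_ρ(τ; d.mass i, d.spin i) → 0` — each near zone converges in
`C⁰`, on every fixed slab `{t*ᵢ = τ, rᵢ ≤ ρ}`, to its OWN reference member. Why plausibly true: it is the capture half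
of the final state picture (Bondi mass loss is monotone and bounded below, angular-momentum exchange is paid by radiated
energy; charts built on the FINAL parameters are normalised by construction); for `|a| ≪ M` and data close to Kerr it
is the content of the Kerr stability theorem. Why it might fail: as the route item (`(Mᵢ, |aᵢ|)` may wander: `J̇` has
no sign; constants degenerate as `χ → 1`; the era's closeness is unweighted in `r`). Size: open-problem — EQUIVALENT to
the crux (this file). Sources: arXiv:1710.01722 Conj. 1 (b)–(c); arXiv:2104.11857; arXiv:2205.14808;
arXiv:2606.28253 Thm. 1.1; Klainerman 2025 §2.3. -/
theorem stub_normalisedEraTwo :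
    ∀ (X : Type) [TopologicalSpace X] [ChartedSpace E3 X] [IsManifold (𝓡 3) ((⊤ : ℕ∞) : WithTop ℕ∞) X] [T2Space X] [SecondCountableTopology X] [ConnectedSpace X], ∀ D ∈ admissibleVacuumData X, ∀ 𝒟 : VacuumCauchyDevelopment D, 𝒟.IsMaximal → Summit.FinalStateConjecture.HasCompleteNullInfinity 𝒟.toCauchyDevelopment → (∃ (m₀ χ : ℝ) (O : Set 𝒟.carrier) (d : QuasiFinalStateDecomposition 𝒟.toSpacetime O 2 ⊤) (R : Fin d.N → ℝ → ℝ), 0 < m₀ ∧ χ < 1 ∧ O = Summit.FinalStateConjecture.exteriorOf 𝒟.toCauchyDevelopment d.charted ∧ Summit.FinalStateConjecture.RaysStayInClosure 𝒟.toCauchyDevelopment O ∧ (∀ i : Fin d.N, Filter.Tendsto (R i) Filter.atTop Filter.atTop ∧ ∀ τ : ℝ, max (Kerr.rPlus (d.mass i) (d.spin i)) 0 + 1 ≤ R i τ) ∧ (∀ τ₁ : ℝ, d.τ₀ < τ₁ → O \ d.certifiedLate R τ₁ ⊆ 𝒟.metric.causalPast 𝒟.timeOrientation (d.certifiedSlab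 R τ₁)) ∧ (∀ i : Fin d.N, Summit.FinalStateConjecture.IsOrthochronous (d.motion i).1) ∧ (∀ (i : Fin d.N) (ρ : ℝ), ∀ᶠ τ in Filter.atTop, ∀ x ∈ (d.background i).truncTimeSlab ρ τ, ∀ w : E4, 𝒟.timeOrientation.IsFutureDirected (mfderiv 𝓘(ℝ, E4) (𝓡 4) (d.chart i) x w) → 0 < ((d.motion i).1 : E4 ≃L[ℝ] E4).symm w 0) ∧ (∀ᶠ τ in Filter.atTop, ∀ x ∈ (Minkowski.backgroundOn d.flatDomain).timeSlab τ, 𝒟.timeOrientation.IsFutureDirected (mfderiv 𝓘(ℝ, E4) (𝓡 4) d.flatChart x (E4.basisVector 0))) ∧ (∀ k : ℕ, Filter.Tendsto (fun τ => 𝒟.toSpacetime.deviationCk (Minkowski.backgroundOn d.flatDomain) d.flatChart k τ) Filter.atTop (nhds 0)) ∧ (∀ (i : Fin d.N) (k : ℕ) (ρ : ℝ) (ε : ENNReal), 0 < ε → ∀ᶠ τ in Filter.atTop, ∃ M a : ℝ, m₀ ≤ M ∧ M ≤ m₀⁻¹ ∧ |a| ≤ χ * M ∧ 𝒟.toSpacetime.truncDeviationCk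 {d.background i with bilin := boostedKerrBilin (d.motion i).1 (d.motion i).2 M a} (d.chart i) k ρ τ ≤ ε ∧ 𝒟.toSpacetime.truncDeviationCk {d.background i with bilin := boostedKerrBilin (d.motion i).1 (d.motion i).2 M a} (d.chart i) k (R i τ) τ ≤ ε)) → ∃ (m₀ χ : ℝ) (O : Set 𝒟.carrier) (d : QuasiFinalStateDecomposition 𝒟.toSpacetime O 2 ⊤) (R : Fin d.N → ℝ → ℝ), 0 < m₀ ∧ χ < 1 ∧ O = Summit.FinalStateConjecture.exteriorOf 𝒟.toCauchyDevelopment d.charted ∧ Summit.FinalStateConjecture.RaysStayInClosure 𝒟.toCauchyDevelopment O ∧ (∀ i : Fin d.N, Filter.Tendsto (R i) Filter.atTop Filter.atTop ∧ ∀ τ : ℝ, max (Kerr.rPlus (d.mass i) (d.spin i)) 0 + 1 ≤ R i τ) ∧ (∀ τ₁ : ℝ, d.τ₀ < τ₁ → O \ d.certifiedLate R τ₁ ⊆ 𝒟.metric.causalPast 𝒟.timeOrientation (d.certifiedSlab R τ₁)) ∧ (∀ i : Fin d.N, Summit.FinalStateConjecture.IsOrthochronous (d.motion i).1) ∧ (∀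 (i : Fin d.N) (ρ : ℝ), ∀ᶠ τ in Filter.atTop, ∀ x ∈ (d.background i).truncTimeSlab ρ τ, ∀ w : E4, 𝒟.timeOrientation.IsFutureDirected (mfderiv 𝓘(ℝ, E4) (𝓡 4) (d.chart i) x w) → 0 < ((d.motion i).1 : E4 ≃L[ℝ] E4).symm w 0) ∧ (∀ᶠ τ in Filter.atTop, ∀ x ∈ (Minkowski.backgroundOn d.flatDomain).timeSlab τ, 𝒟.timeOrientation.IsFutureDirected (mfderiv 𝓘(ℝ, E4) (𝓡 4) d.flatChart x (E4.basisVector 0))) ∧ Filter.Tendsto (fun τ => 𝒟.toSpacetime.deviationCk (Minkowski.backgroundOn d.flatDomain) d.flatChart 2 τ) Filter.atTop (nhds 0) ∧ (∀ (i : Fin d.N) (ρ : ℝ) (ε : ENNReal), 0 < ε → ∀ᶠ τ in Filter.atTop, ∃ M a : ℝ, m₀ ≤ M ∧ M ≤ m₀⁻¹ ∧ |a| ≤ χ * M ∧ 𝒟.toSpacetime.truncDeviationCk {d.background i with bilin := boostedKerrBilin (d.motion i).1 (d.motion i).2 M a} (d.chart i) 2 ρ τ ≤ ε ∧ 𝒟.toSpacetime.truncDeviationCk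 {d.background i with bilin := boostedKerrBilin (d.motion i).1 (d.motion i).2 M a} (d.chart i) 2 (R i τ) τ ≤ ε) ∧ (∀ (i : Fin d.N) (ρ : ℝ), Filter.Tendsto (fun τ => 𝒟.toSpacetime.truncDeviationCk {d.background i with bilin := boostedKerrBilin (d.motion i).1 (d.motion i).2 (d.mass i) (d.spin i)} (d.chart i) 0 ρ τ) Filter.atTop (nhds 0)) := by
  sorry

/-! ## This cycle's bookkeeping stubs (wave of lead c4; both provable, sizes M) -/

/-- **Stub F — forward, order two** (`stub_conclOfNormalisedEraTwo`): for ONE maximal development with complete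
`𝓘⁺`, a `C⁰`-normalised honest era system AT ORDER TWO settles as the re-typed Statement demands. Proof route
(bookkeeping over landed analysis): chart by chart the capture upgrade at the single order `k = 2`
(`captureA_mem_window` from the order-0 part by monotonicity in `k`, `captureB_tendsto_fixed`,
`captureC_tendsto_growing`), sub-extremality `|a| ≤ χM < M` from the window, the same-parameter rechart
`QuasiFinalStateDecomposition.toFinalStateDecomposition` (cf. `dyadicCapture_honestRechart_of_sameParams`) and
`stub_settledRechart`. Size: M. [cite: DafermosLuk2017, Conjecture 1 (b)–(c)] -/
theorem stub_conclOfNormalisedEraTwo :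
    ∀ (X : Type) [TopologicalSpace X] [ChartedSpace E3 X] [IsManifold (𝓡 3) ((⊤ : ℕ∞) : WithTop ℕ∞) X] [T2Space X] [SecondCountableTopology X] [ConnectedSpace X], ∀ D ∈ admissibleVacuumData X, ∀ 𝒟 : VacuumCauchyDevelopment D, 𝒟.IsMaximal → Summit.FinalStateConjecture.HasCompleteNullInfinity 𝒟.toCauchyDevelopment → (∃ (m₀ χ : ℝ) (O : Set 𝒟.carrier) (d : QuasiFinalStateDecomposition 𝒟.toSpacetime O 2 ⊤) (R : Fin d.N → ℝ → ℝ), 0 < m₀ ∧ χ < 1 ∧ O = Summit.FinalStateConjecture.exteriorOf 𝒟.toCauchyDevelopment d.charted ∧ Summit.FinalStateConjecture.RaysStayInClosure 𝒟.toCauchyDevelopment O ∧ (∀ i : Fin d.N, Filter.Tendsto (R i) Filter.atTop Filter.atTop ∧ ∀ τ : ℝ, max (Kerr.rPlus (d.mass i) (d.spin i)) 0 + 1 ≤ R i τ) ∧ (∀ τ₁ : ℝ, d.τ₀ < τ₁ → O \ d.certifiedLate R τ₁ ⊆ 𝒟.metric.causalPast 𝒟.timeOrientation (d.certifiedSlab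 R τ₁)) ∧ (∀ i : Fin d.N, Summit.FinalStateConjecture.IsOrthochronous (d.motion i).1) ∧ (∀ (i : Fin d.N) (ρ : ℝ), ∀ᶠ τ in Filter.atTop, ∀ x ∈ (d.background i).truncTimeSlab ρ τ, ∀ w : E4, 𝒟.timeOrientation.IsFutureDirected (mfderiv 𝓘(ℝ, E4) (𝓡 4) (d.chart i) x w) → 0 < ((d.motion i).1 : E4 ≃L[ℝ] E4).symm w 0) ∧ (∀ᶠ τ in Filter.atTop, ∀ x ∈ (Minkowski.backgroundOn d.flatDomain).timeSlab τ, 𝒟.timeOrientation.IsFutureDirected (mfderiv 𝓘(ℝ, E4) (𝓡 4) d.flatChart x (E4.basisVector 0))) ∧ Filter.Tendsto (fun τ => 𝒟.toSpacetime.deviationCk (Minkowski.backgroundOn d.flatDomain) d.flatChart 2 τ) Filter.atTop (nhds 0) ∧ (∀ (i : Fin d.N) (ρ : ℝ) (ε : ENNReal), 0 < ε → ∀ᶠ τ in Filter.atTop, ∃ M a : ℝ, m₀ ≤ M ∧ M ≤ m₀⁻¹ ∧ |a| ≤ χ * M ∧ 𝒟.toSpacetime.truncDeviationCk {d.background i with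 bilin := boostedKerrBilin (d.motion i).1 (d.motion i).2 M a} (d.chart i) 2 ρ τ ≤ ε ∧ 𝒟.toSpacetime.truncDeviationCk {d.background i with bilin := boostedKerrBilin (d.motion i).1 (d.motion i).2 M a} (d.chart i) 2 (R i τ) τ ≤ ε) ∧ (∀ (i : Fin d.N) (ρ : ℝ), Filter.Tendsto (fun τ => 𝒟.toSpacetime.truncDeviationCk {d.background i with bilin := boostedKerrBilin (d.motion i).1 (d.motion i).2 (d.mass i) (d.spin i)} (d.chart i) 0 ρ τ) Filter.atTop (nhds 0))) → (∃ (O' : Set 𝒟.carrier) (d' : FinalStateDecomposition 𝒟.toSpacetime O' 2), (∀ i, Kerr.IsSubextremal (d'.mass i) (d'.spin i)) ∧ O' = Summit.FinalStateConjecture.exteriorOf 𝒟.toCauchyDevelopment d'.charted ∧ Summit.FinalStateConjecture.RaysStayInClosure 𝒟.toCauchyDevelopment O' ∧ Summit.FinalStateConjecture.HasExhaustiveCharts d' ∧ Summit.FinalStateConjecture.IsFutureOriented d') := by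
  sorry

/-- **Stub B — backward / necessity** (`stub_normalisedEraTwoOfConcl`): for ONE maximal development, the settling
conjunct `CONCL(𝒟)` already provides a `C⁰`-normalised honest era system at order two: `d := d'.toQuasi` (`⊤ > 0`),
window `m₀ := (1 + Σᵢ (Mᵢ + Mᵢ⁻¹))⁻¹`, `χ := 1 − (1 + Σᵢ (1 − |aᵢ|/Mᵢ)⁻¹)⁻¹ < 1`, radii from `HasExhaustiveCharts`,
`charted / certifiedLate / certifiedSlab / background` agree by `rfl`, windowed closeness witnessed by the labels
themselves, `C⁰` normalisation by monotonicity in `k`, and the covector orientation clause from the vector form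
`IsFutureOriented` (ii) plus `C⁰` closeness: with `U = dΨ(ΛV)` future timelike and `W = dΨ w` future causal,
`g(U, W) ≤ 0` (`IsFutureDirected.val_nonpos`), `|g(U,W) + (Λ⁻¹w)⁰| ≤ δ‖ΛV‖‖w‖` (`Kerr.bilin_timeVector`,
`dyadicCapture_abs_pullback_sub_bilin_le`) and `‖Λ⁻¹w‖ ≤ 2|(Λ⁻¹w)⁰|` from causality (`H ≥ 0`), whence
`(Λ⁻¹w)⁰ > 0` once `δ‖Λ‖²` is small. Size: M. [cite: ONeill1983, Ch. 5  p. 145] [cite: arXiv08110354, §5.1] -/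
theorem stub_normalisedEraTwoOfConcl :
    ∀ (X : Type) [TopologicalSpace X] [ChartedSpace E3 X] [IsManifold (𝓡 3) ((⊤ : ℕ∞) : WithTop ℕ∞) X] [T2Space X] [SecondCountableTopology X] [ConnectedSpace X], ∀ D ∈ admissibleVacuumData X, ∀ 𝒟 : VacuumCauchyDevelopment D, 𝒟.IsMaximal → Summit.FinalStateConjecture.HasCompleteNullInfinity 𝒟.toCauchyDevelopment → (∃ (O' : Set 𝒟.carrier) (d' : FinalStateDecomposition 𝒟.toSpacetime O' 2), (∀ i, Kerr.IsSubextremal (d'.mass i) (d'.spin i)) ∧ O' = Summit.FinalStateConjecture.exteriorOf 𝒟.toCauchyDevelopment d'.charted ∧ Summit.FinalStateConjecture.RaysStayInClosure 𝒟.toCauchyDevelopment O' ∧ Summit.FinalStateConjecture.HasExhaustiveCharts d' ∧ Summit.FinalStateConjecture.IsFutureOriented d') → ∃ (m₀ χ : ℝ) (O : Set 𝒟.carrier) (d : QuasiFinalStateDecomposition 𝒟.toSpacetime O 2 ⊤) (R : Fin d.N → ℝ → ℝ), 0 < m₀ ∧ χ < 1 ∧ O = Summit.FinalStateConjecture.exteriorOf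 𝒟.toCauchyDevelopment d.charted ∧ Summit.FinalStateConjecture.RaysStayInClosure 𝒟.toCauchyDevelopment O ∧ (∀ i : Fin d.N, Filter.Tendsto (R i) Filter.atTop Filter.atTop ∧ ∀ τ : ℝ, max (Kerr.rPlus (d.mass i) (d.spin i)) 0 + 1 ≤ R i τ) ∧ (∀ τ₁ : ℝ, d.τ₀ < τ₁ → O \ d.certifiedLate R τ₁ ⊆ 𝒟.metric.causalPast 𝒟.timeOrientation (d.certifiedSlab R τ₁)) ∧ (∀ i : Fin d.N, Summit.FinalStateConjecture.IsOrthochronous (d.motion i).1) ∧ (∀ (i : Fin d.N) (ρ : ℝ), ∀ᶠ τ in Filter.atTop, ∀ x ∈ (d.background i).truncTimeSlab ρ τ, ∀ w : E4, 𝒟.timeOrientation.IsFutureDirected (mfderiv 𝓘(ℝ, E4) (𝓡 4) (d.chart i) x w) → 0 < ((d.motion i).1 : E4 ≃L[ℝ] E4).symm w 0) ∧ (∀ᶠ τ in Filter.atTop, ∀ x ∈ (Minkowski.backgroundOn d.flatDomain).timeSlab τ, 𝒟.timeOrientation.IsFutureDirected (mfderiv 𝓘(ℝ, E4) (𝓡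 4) d.flatChart x (E4.basisVector 0))) ∧ Filter.Tendsto (fun τ => 𝒟.toSpacetime.deviationCk (Minkowski.backgroundOn d.flatDomain) d.flatChart 2 τ) Filter.atTop (nhds 0) ∧ (∀ (i : Fin d.N) (ρ : ℝ) (ε : ENNReal), 0 < ε → ∀ᶠ τ in Filter.atTop, ∃ M a : ℝ, m₀ ≤ M ∧ M ≤ m₀⁻¹ ∧ |a| ≤ χ * M ∧ 𝒟.toSpacetime.truncDeviationCk {d.background i with bilin := boostedKerrBilin (d.motion i).1 (d.motion i).2 M a} (d.chart i) 2 ρ τ ≤ ε ∧ 𝒟.toSpacetime.truncDeviationCk {d.background i with bilin := boostedKerrBilin (d.motion i).1 (d.motion i).2 M a} (d.chart i) 2 (R i τ) τ ≤ ε) ∧ (∀ (i : Fin d.N) (ρ : ℝ), Filter.Tendsto (fun τ => 𝒟.toSpacetime.truncDeviationCk {d.background i with bilin := boostedKerrBilin (d.motion i).1 (d.motion i).2 (d.mass i) (d.spin i)} (d.chart i) 0 ρ τ) Filter.atTop (nhds 0)) := by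
  sorry

/-! ## Monotonicity of the reshape v6 → v7 (sorry-free) -/

-- the structure-update backgrounds of the registered signatures unfold slowly
set_option synthInstance.maxHeartbeats 200000 in
set_option maxHeartbeats 3200000 in
/-- v6's registered open stub `stub_normalisedEra` (signature verbatim as the hypothesis) implies v7's
`stub_normalisedEraTwo`: instantiate the flat-zone and windowed-closeness clauses at `k = 2`. [folklore] -/
theorem stub_normalisedEraTwo_of_v6
    (h : ∀ (X : Type) [TopologicalSpace X] [ChartedSpace E3 X] [IsManifold (𝓡 3) ((⊤ : ℕ∞) : WithTop ℕ∞) X] [T2Space X] [SecondCountableTopology X] [ConnectedSpace X], ∀ D ∈ admissibleVacuumData X, ∀ 𝒟 : VacuumCauchyDevelopment D, 𝒟.IsMaximal → Summit.FinalStateConjecture.HasCompleteNullInfinity 𝒟.toCauchyDevelopment → (∃ (m₀ χ : ℝ) (O : Set 𝒟.carrier) (d : QuasiFinalStateDecomposition 𝒟.toSpacetime O 2 ⊤) (R : Fin d.N → ℝ → ℝ), 0 < m₀ ∧ χ < 1 ∧ O = Summit.FinalStateConjecture.exteriorOf 𝒟.toCauchyDevelopment d.charted ∧ Summit.FinalStateConjecture.RaysStayInClosure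 𝒟.toCauchyDevelopment O ∧ (∀ i : Fin d.N, Filter.Tendsto (R i) Filter.atTop Filter.atTop ∧ ∀ τ : ℝ, max (Kerr.rPlus (d.mass i) (d.spin i)) 0 + 1 ≤ R i τ) ∧ (∀ τ₁ : ℝ, d.τ₀ < τ₁ → O \ d.certifiedLate R τ₁ ⊆ 𝒟.metric.causalPast 𝒟.timeOrientation (d.certifiedSlab R τ₁)) ∧ (∀ i : Fin d.N, Summit.FinalStateConjecture.IsOrthochronous (d.motion i).1) ∧ (∀ (i : Fin d.N) (ρ : ℝ), ∀ᶠ τ in Filter.atTop, ∀ x ∈ (d.background i).truncTimeSlab ρ τ, ∀ w : E4, 𝒟.timeOrientation.IsFutureDirected (mfderiv 𝓘(ℝ, E4) (𝓡 4) (d.chart i) x w) → 0 < ((d.motion i).1 : E4 ≃L[ℝ] E4).symm w 0) ∧ (∀ᶠ τ in Filter.atTop, ∀ x ∈ (Minkowski.backgroundOn d.flatDomain).timeSlab τ, 𝒟.timeOrientation.IsFutureDirected (mfderiv 𝓘(ℝ, E4) (𝓡 4) d.flatChart x (E4.basisVector 0))) ∧ (∀ k : ℕ, Filter.Tendsto (fun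 τ => 𝒟.toSpacetime.deviationCk (Minkowski.backgroundOn d.flatDomain) d.flatChart k τ) Filter.atTop (nhds 0)) ∧ (∀ (i : Fin d.N) (k : ℕ) (ρ : ℝ) (ε : ENNReal), 0 < ε → ∀ᶠ τ in Filter.atTop, ∃ M a : ℝ, m₀ ≤ M ∧ M ≤ m₀⁻¹ ∧ |a| ≤ χ * M ∧ 𝒟.toSpacetime.truncDeviationCk {d.background i with bilin := boostedKerrBilin (d.motion i).1 (d.motion i).2 M a} (d.chart i) k ρ τ ≤ ε ∧ 𝒟.toSpacetime.truncDeviationCk {d.background i with bilin := boostedKerrBilin (d.motion i).1 (d.motion i).2 M a} (d.chart i) k (R i τ) τ ≤ ε)) → ∃ (m₀ χ : ℝ) (O : Set 𝒟.carrier) (d : QuasiFinalStateDecomposition 𝒟.toSpacetime O 2 ⊤) (R : Fin d.N → ℝ → ℝ), 0 < m₀ ∧ χ < 1 ∧ O = Summit.FinalStateConjecture.exteriorOf 𝒟.toCauchyDevelopment d.charted ∧ Summit.FinalStateConjecture.RaysStayInClosure 𝒟.toCauchyDevelopment O ∧ (∀ i : Fin d.N, Filter.Tendsto (R i) Filter.atTop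 Filter.atTop ∧ ∀ τ : ℝ, max (Kerr.rPlus (d.mass i) (d.spin i)) 0 + 1 ≤ R i τ) ∧ (∀ τ₁ : ℝ, d.τ₀ < τ₁ → O \ d.certifiedLate R τ₁ ⊆ 𝒟.metric.causalPast 𝒟.timeOrientation (d.certifiedSlab R τ₁)) ∧ (∀ i : Fin d.N, Summit.FinalStateConjecture.IsOrthochronous (d.motion i).1) ∧ (∀ (i : Fin d.N) (ρ : ℝ), ∀ᶠ τ in Filter.atTop, ∀ x ∈ (d.background i).truncTimeSlab ρ τ, ∀ w : E4, 𝒟.timeOrientation.IsFutureDirected (mfderiv 𝓘(ℝ, E4) (𝓡 4) (d.chart i) x w) → 0 < ((d.motion i).1 : E4 ≃L[ℝ] E4).symm w 0) ∧ (∀ᶠ τ in Filter.atTop, ∀ x ∈ (Minkowski.backgroundOn d.flatDomain).timeSlab τ, 𝒟.timeOrientation.IsFutureDirected (mfderiv 𝓘(ℝ, E4) (𝓡 4) d.flatChart x (E4.basisVector 0))) ∧ (∀ k : ℕ, Filter.Tendsto (fun τ => 𝒟.toSpacetime.deviationCk (Minkowski.backgroundOn d.flatDomain) d.flatChart k τ)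 Filter.atTop (nhds 0)) ∧ (∀ (i : Fin d.N) (k : ℕ) (ρ : ℝ) (ε : ENNReal), 0 < ε → ∀ᶠ τ in Filter.atTop, ∃ M a : ℝ, m₀ ≤ M ∧ M ≤ m₀⁻¹ ∧ |a| ≤ χ * M ∧ 𝒟.toSpacetime.truncDeviationCk {d.background i with bilin := boostedKerrBilin (d.motion i).1 (d.motion i).2 M a} (d.chart i) k ρ τ ≤ ε ∧ 𝒟.toSpacetime.truncDeviationCk {d.background i with bilin := boostedKerrBilin (d.motion i).1 (d.motion i).2 M a} (d.chart i) k (R i τ) τ ≤ ε) ∧ (∀ (i : Fin d.N) (ρ : ℝ), Filter.Tendsto (fun τ => 𝒟.toSpacetime.truncDeviationCk {d.background i with bilin := boostedKerrBilin (d.motion i).1 (d.motion i).2 (d.mass i) (d.spin i)} (d.chart i) 0 ρ τ) Filter.atTop (nhds 0))) :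
    ∀ (X : Type) [TopologicalSpace X] [ChartedSpace E3 X] [IsManifold (𝓡 3) ((⊤ : ℕ∞) : WithTop ℕ∞) X] [T2Space X] [SecondCountableTopology X] [ConnectedSpace X], ∀ D ∈ admissibleVacuumData X, ∀ 𝒟 : VacuumCauchyDevelopment D, 𝒟.IsMaximal → Summit.FinalStateConjecture.HasCompleteNullInfinity 𝒟.toCauchyDevelopment → (∃ (m₀ χ : ℝ) (O : Set 𝒟.carrier) (d : QuasiFinalStateDecomposition 𝒟.toSpacetime O 2 ⊤) (R : Fin d.N → ℝ → ℝ), 0 < m₀ ∧ χ < 1 ∧ O = Summit.FinalStateConjecture.exteriorOf 𝒟.toCauchyDevelopment d.charted ∧ Summit.FinalStateConjecture.RaysStayInClosure 𝒟.toCauchyDevelopment O ∧ (∀ i : Fin d.N, Filter.Tendsto (R i) Filter.atTop Filter.atTop ∧ ∀ τ : ℝ, max (Kerr.rPlus (d.mass i) (d.spin i)) 0 + 1 ≤ R i τ) ∧ (∀ τ₁ : ℝ, d.τ₀ < τ₁ → O \ d.certifiedLate R τ₁ ⊆ 𝒟.metric.causalPast 𝒟.timeOrientation (d.certifiedSlab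 R τ₁)) ∧ (∀ i : Fin d.N, Summit.FinalStateConjecture.IsOrthochronous (d.motion i).1) ∧ (∀ (i : Fin d.N) (ρ : ℝ), ∀ᶠ τ in Filter.atTop, ∀ x ∈ (d.background i).truncTimeSlab ρ τ, ∀ w : E4, 𝒟.timeOrientation.IsFutureDirected (mfderiv 𝓘(ℝ, E4) (𝓡 4) (d.chart i) x w) → 0 < ((d.motion i).1 : E4 ≃L[ℝ] E4).symm w 0) ∧ (∀ᶠ τ in Filter.atTop, ∀ x ∈ (Minkowski.backgroundOn d.flatDomain).timeSlab τ, 𝒟.timeOrientation.IsFutureDirected (mfderiv 𝓘(ℝ, E4) (𝓡 4) d.flatChart x (E4.basisVector 0))) ∧ (∀ k : ℕ, Filter.Tendsto (fun τ => 𝒟.toSpacetime.deviationCk (Minkowski.backgroundOn d.flatDomain) d.flatChart k τ) Filter.atTop (nhds 0)) ∧ (∀ (i : Fin d.N) (k : ℕ) (ρ : ℝ) (ε : ENNReal), 0 < ε → ∀ᶠ τ in Filter.atTop, ∃ M a : ℝ, m₀ ≤ M ∧ M ≤ m₀⁻¹ ∧ |a| ≤ χ * M ∧ 𝒟.toSpacetime.truncDeviationCk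 {d.background i with bilin := boostedKerrBilin (d.motion i).1 (d.motion i).2 M a} (d.chart i) k ρ τ ≤ ε ∧ 𝒟.toSpacetime.truncDeviationCk {d.background i with bilin := boostedKerrBilin (d.motion i).1 (d.motion i).2 M a} (d.chart i) k (R i τ) τ ≤ ε)) → ∃ (m₀ χ : ℝ) (O : Set 𝒟.carrier) (d : QuasiFinalStateDecomposition 𝒟.toSpacetime O 2 ⊤) (R : Fin d.N → ℝ → ℝ), 0 < m₀ ∧ χ < 1 ∧ O = Summit.FinalStateConjecture.exteriorOf 𝒟.toCauchyDevelopment d.charted ∧ Summit.FinalStateConjecture.RaysStayInClosure 𝒟.toCauchyDevelopment O ∧ (∀ i : Fin d.N, Filter.Tendsto (R i) Filter.atTop Filter.atTop ∧ ∀ τ : ℝ, max (Kerr.rPlus (d.mass i) (d.spin i)) 0 + 1 ≤ R i τ) ∧ (∀ τ₁ : ℝ, d.τ₀ < τ₁ → O \ d.certifiedLate R τ₁ ⊆ 𝒟.metric.causalPast 𝒟.timeOrientation (d.certifiedSlab R τ₁)) ∧ (∀ i : Fin d.N, Summit.FinalStateConjecture.IsOrthochronous (d.motion i).1) ∧ (∀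 (i : Fin d.N) (ρ : ℝ), ∀ᶠ τ in Filter.atTop, ∀ x ∈ (d.background i).truncTimeSlab ρ τ, ∀ w : E4, 𝒟.timeOrientation.IsFutureDirected (mfderiv 𝓘(ℝ, E4) (𝓡 4) (d.chart i) x w) → 0 < ((d.motion i).1 : E4 ≃L[ℝ] E4).symm w 0) ∧ (∀ᶠ τ in Filter.atTop, ∀ x ∈ (Minkowski.backgroundOn d.flatDomain).timeSlab τ, 𝒟.timeOrientation.IsFutureDirected (mfderiv 𝓘(ℝ, E4) (𝓡 4) d.flatChart x (E4.basisVector 0))) ∧ Filter.Tendsto (fun τ => 𝒟.toSpacetime.deviationCk (Minkowski.backgroundOn d.flatDomain) d.flatChart 2 τ) Filter.atTop (nhds 0) ∧ (∀ (i : Fin d.N) (ρ : ℝ) (ε : ENNReal), 0 < ε → ∀ᶠ τ in Filter.atTop, ∃ M a : ℝ, m₀ ≤ M ∧ M ≤ m₀⁻¹ ∧ |a| ≤ χ * M ∧ 𝒟.toSpacetime.truncDeviationCk {d.background i with bilin := boostedKerrBilin (d.motion i).1 (d.motion i).2 M a} (d.chart i) 2 ρ τ ≤ ε ∧ 𝒟.toSpacetime.truncDeviationCk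 {d.background i with bilin := boostedKerrBilin (d.motion i).1 (d.motion i).2 M a} (d.chart i) 2 (R i τ) τ ≤ ε) ∧ (∀ (i : Fin d.N) (ρ : ℝ), Filter.Tendsto (fun τ => 𝒟.toSpacetime.truncDeviationCk {d.background i with bilin := boostedKerrBilin (d.motion i).1 (d.motion i).2 (d.mass i) (d.spin i)} (d.chart i) 0 ρ τ) Filter.atTop (nhds 0)) := by
  intro X _ _ _ _ _ _ D hD 𝒟 hmax hI hera
  obtain ⟨m₀, χ, O, d, R, hm₀, hχ, hO, hrays, hR, hexh, horth, hcov, hflat0, hflat, hW, hN⟩ :=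
    h X D hD 𝒟 hmax hI hera
  exact ⟨m₀, χ, O, d, R, hm₀, hχ, hO, hrays, hR, hexh, horth, hcov, hflat0, hflat 2,
    fun i ρ ε hε => hW i 2 ρ ε hε, hN⟩

/-! ## The composition: the open stub proves the crux BY NAME, and is equivalent to it -/

/-- **THE SKELETON THEOREM.** The crux
`Summit.FinalStateConjecture.FinalStateConjecture.Theses.LogTimeThreeAnnuli.DyadicCapture`, concluded BY NAME from
the declared open stub `stub_normalisedEraTwo` through the forward bookkeeping stub `stub_conclOfNormalisedEraTwo`.
[cite: DafermosLuk2017, Conjecture 1 (b)–(c)] -/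
theorem DyadicCapture_of :
    Summit.FinalStateConjecture.FinalStateConjecture.Theses.LogTimeThreeAnnuli.DyadicCapture :=
  fun X _ _ _ _ _ _ D hD 𝒟 hmax hI hera ↦
    stub_conclOfNormalisedEraTwo X D hD 𝒟 hmax hI (stub_normalisedEraTwo X D hD 𝒟 hmax hI hera)

/-- **OPTIMALITY CERTIFICATE of the line**: the statement of the open stub `stub_normalisedEraTwo` is EQUIVALENT to
the crux (modulo the two bookkeeping stubs of this cycle; sorry-free otherwise). The line `registered` cannot be cut
thinner: its open content is the crux's own content. [cite: DafermosLuk2017, Conjecture 1 (b)–(c)] -/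
theorem stub_normalisedEraTwo_iff_dyadicCapture :
    (∀ (X : Type) [TopologicalSpace X] [ChartedSpace E3 X] [IsManifold (𝓡 3) ((⊤ : ℕ∞) : WithTop ℕ∞) X] [T2Space X] [SecondCountableTopology X] [ConnectedSpace X], ∀ D ∈ admissibleVacuumData X, ∀ 𝒟 : VacuumCauchyDevelopment D, 𝒟.IsMaximal → Summit.FinalStateConjecture.HasCompleteNullInfinity 𝒟.toCauchyDevelopment → (∃ (m₀ χ : ℝ) (O : Set 𝒟.carrier) (d : QuasiFinalStateDecomposition 𝒟.toSpacetime O 2 ⊤) (R : Fin d.N → ℝ → ℝ), 0 < m₀ ∧ χ < 1 ∧ O = Summit.FinalStateConjecture.exteriorOf 𝒟.toCauchyDevelopment d.charted ∧ Summit.FinalStateConjecture.RaysStayInClosure 𝒟.toCauchyDevelopment O ∧ (∀ i : Fin d.N, Filter.Tendsto (R i) Filter.atTop Filter.atTop ∧ ∀ τ : ℝ, max (Kerr.rPlus (d.mass i) (d.spin i)) 0 + 1 ≤ R i τ) ∧ (∀ τ₁ : ℝ, d.τ₀ < τ₁ → O \ d.certifiedLate R τ₁ ⊆ 𝒟.metric.causalPast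 𝒟.timeOrientation (d.certifiedSlab R τ₁)) ∧ (∀ i : Fin d.N, Summit.FinalStateConjecture.IsOrthochronous (d.motion i).1) ∧ (∀ (i : Fin d.N) (ρ : ℝ), ∀ᶠ τ in Filter.atTop, ∀ x ∈ (d.background i).truncTimeSlab ρ τ, ∀ w : E4, 𝒟.timeOrientation.IsFutureDirected (mfderiv 𝓘(ℝ, E4) (𝓡 4) (d.chart i) x w) → 0 < ((d.motion i).1 : E4 ≃L[ℝ] E4).symm w 0) ∧ (∀ᶠ τ in Filter.atTop, ∀ x ∈ (Minkowski.backgroundOn d.flatDomain).timeSlab τ, 𝒟.timeOrientation.IsFutureDirected (mfderiv 𝓘(ℝ, E4) (𝓡 4) d.flatChart x (E4.basisVector 0))) ∧ (∀ k : ℕ, Filter.Tendsto (fun τ => 𝒟.toSpacetime.deviationCk (Minkowski.backgroundOn d.flatDomain) d.flatChart k τ) Filter.atTop (nhds 0)) ∧ (∀ (i : Fin d.N) (k : ℕ) (ρ : ℝ) (ε : ENNReal), 0 < ε → ∀ᶠ τ in Filter.atTop, ∃ M a : ℝ, m₀ ≤ M ∧ M ≤ m₀⁻¹ ∧ |a|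 ≤ χ * M ∧ 𝒟.toSpacetime.truncDeviationCk {d.background i with bilin := boostedKerrBilin (d.motion i).1 (d.motion i).2 M a} (d.chart i) k ρ τ ≤ ε ∧ 𝒟.toSpacetime.truncDeviationCk {d.background i with bilin := boostedKerrBilin (d.motion i).1 (d.motion i).2 M a} (d.chart i) k (R i τ) τ ≤ ε)) → ∃ (m₀ χ : ℝ) (O : Set 𝒟.carrier) (d : QuasiFinalStateDecomposition 𝒟.toSpacetime O 2 ⊤) (R : Fin d.N → ℝ → ℝ), 0 < m₀ ∧ χ < 1 ∧ O = Summit.FinalStateConjecture.exteriorOf 𝒟.toCauchyDevelopment d.charted ∧ Summit.FinalStateConjecture.RaysStayInClosure 𝒟.toCauchyDevelopment O ∧ (∀ i : Fin d.N, Filter.Tendsto (R i) Filter.atTop Filter.atTop ∧ ∀ τ : ℝ, max (Kerr.rPlus (d.mass i) (d.spin i)) 0 + 1 ≤ R i τ) ∧ (∀ τ₁ : ℝ, d.τ₀ < τ₁ → O \ d.certifiedLate R τ₁ ⊆ 𝒟.metric.causalPast 𝒟.timeOrientation (d.certifiedSlab R τ₁)) ∧ (∀ i : Fin d.N, Summit.FinalStateConjecture.IsOrthochronous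 (d.motion i).1) ∧ (∀ (i : Fin d.N) (ρ : ℝ), ∀ᶠ τ in Filter.atTop, ∀ x ∈ (d.background i).truncTimeSlab ρ τ, ∀ w : E4, 𝒟.timeOrientation.IsFutureDirected (mfderiv 𝓘(ℝ, E4) (𝓡 4) (d.chart i) x w) → 0 < ((d.motion i).1 : E4 ≃L[ℝ] E4).symm w 0) ∧ (∀ᶠ τ in Filter.atTop, ∀ x ∈ (Minkowski.backgroundOn d.flatDomain).timeSlab τ, 𝒟.timeOrientation.IsFutureDirected (mfderiv 𝓘(ℝ, E4) (𝓡 4) d.flatChart x (E4.basisVector 0))) ∧ Filter.Tendsto (fun τ => 𝒟.toSpacetime.deviationCk (Minkowski.backgroundOn d.flatDomain) d.flatChart 2 τ) Filter.atTop (nhds 0) ∧ (∀ (i : Fin d.N) (ρ : ℝ) (ε : ENNReal), 0 < ε → ∀ᶠ τ in Filter.atTop, ∃ M a : ℝ, m₀ ≤ M ∧ M ≤ m₀⁻¹ ∧ |a| ≤ χ * M ∧ 𝒟.toSpacetime.truncDeviationCk {d.background i with bilin := boostedKerrBilin (d.motion i).1 (d.motion i).2 M a} (d.chart i) 2 ρ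 τ ≤ ε ∧ 𝒟.toSpacetime.truncDeviationCk {d.background i with bilin := boostedKerrBilin (d.motion i).1 (d.motion i).2 M a} (d.chart i) 2 (R i τ) τ ≤ ε) ∧ (∀ (i : Fin d.N) (ρ : ℝ), Filter.Tendsto (fun τ => 𝒟.toSpacetime.truncDeviationCk {d.background i with bilin := boostedKerrBilin (d.motion i).1 (d.motion i).2 (d.mass i) (d.spin i)} (d.chart i) 0 ρ τ) Filter.atTop (nhds 0))) ↔
      Summit.FinalStateConjecture.FinalStateConjecture.Theses.LogTimeThreeAnnuli.DyadicCapture :=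
  ⟨fun h X _ _ _ _ _ _ D hD 𝒟 hmax hI hera ↦
      stub_conclOfNormalisedEraTwo X D hD 𝒟 hmax hI (h X D hD 𝒟 hmax hI hera),
    fun hC X _ _ _ _ _ _ D hD 𝒟 hmax hI hera ↦
      stub_normalisedEraTwoOfConcl X D hD 𝒟 hmax hI (hC X D hD 𝒟 hmax hI hera)⟩

/-- **The dispersal regime of the crux is settled** (LANDED, `Theorems.concl_of_era_dispersal`; informational): an era
WITHOUT holes (`d.N = 0`) settles — the normalisation is vacuous. The crux is open only through its `N ≥ 1` instances.
[cite: DafermosLuk2017, Conjecture 1 (b)–(c)] -/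
theorem concl_of_era_dispersal :
    ∀ (X : Type) [TopologicalSpace X] [ChartedSpace E3 X] [IsManifold (𝓡 3) ((⊤ : ℕ∞) : WithTop ℕ∞) X] [T2Space X] [SecondCountableTopology X] [ConnectedSpace X], ∀ D ∈ admissibleVacuumData X, ∀ 𝒟 : VacuumCauchyDevelopment D, 𝒟.IsMaximal → Summit.FinalStateConjecture.HasCompleteNullInfinity 𝒟.toCauchyDevelopment → (∃ (m₀ χ : ℝ) (O : Set 𝒟.carrier) (d : QuasiFinalStateDecomposition 𝒟.toSpacetime O 2 ⊤) (R : Fin d.N → ℝ → ℝ), d.N = 0 ∧ 0 < m₀ ∧ χ < 1 ∧ O = Summit.FinalStateConjecture.exteriorOf 𝒟.toCauchyDevelopment d.charted ∧ Summit.FinalStateConjecture.RaysStayInClosure 𝒟.toCauchyDevelopment O ∧ (∀ i : Fin d.N, Filter.Tendsto (R i) Filter.atTop Filter.atTop ∧ ∀ τ : ℝ, max (Kerr.rPlus (d.mass i) (d.spin i)) 0 + 1 ≤ R i τ) ∧ (∀ τ₁ : ℝ, d.τ₀ < τ₁ → O \ d.certifiedLate R τ₁ ⊆ 𝒟.metric.causalPast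 𝒟.timeOrientation (d.certifiedSlab R τ₁)) ∧ (∀ i : Fin d.N, Summit.FinalStateConjecture.IsOrthochronous (d.motion i).1) ∧ (∀ (i : Fin d.N) (ρ : ℝ), ∀ᶠ τ in Filter.atTop, ∀ x ∈ (d.background i).truncTimeSlab ρ τ, ∀ w : E4, 𝒟.timeOrientation.IsFutureDirected (mfderiv 𝓘(ℝ, E4) (𝓡 4) (d.chart i) x w) → 0 < ((d.motion i).1 : E4 ≃L[ℝ] E4).symm w 0) ∧ (∀ᶠ τ in Filter.atTop, ∀ x ∈ (Minkowski.backgroundOn d.flatDomain).timeSlab τ, 𝒟.timeOrientation.IsFutureDirected (mfderiv 𝓘(ℝ, E4) (𝓡 4) d.flatChart x (E4.basisVector 0))) ∧ (∀ k : ℕ, Filter.Tendsto (fun τ => 𝒟.toSpacetime.deviationCk (Minkowski.backgroundOn d.flatDomain) d.flatChart k τ) Filter.atTop (nhds 0)) ∧ (∀ (i : Fin d.N) (k : ℕ) (ρ : ℝ) (ε : ENNReal), 0 < ε → ∀ᶠ τ in Filter.atTop, ∃ M a : ℝ, m₀ ≤ M ∧ M ≤ m₀⁻¹ ∧ |a|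 ≤ χ * M ∧ 𝒟.toSpacetime.truncDeviationCk {d.background i with bilin := boostedKerrBilin (d.motion i).1 (d.motion i).2 M a} (d.chart i) k ρ τ ≤ ε ∧ 𝒟.toSpacetime.truncDeviationCk {d.background i with bilin := boostedKerrBilin (d.motion i).1 (d.motion i).2 M a} (d.chart i) k (R i τ) τ ≤ ε)) → (∃ (O' : Set 𝒟.carrier) (d' : FinalStateDecomposition 𝒟.toSpacetime O' 2), (∀ i, Kerr.IsSubextremal (d'.mass i) (d'.spin i)) ∧ O' = Summit.FinalStateConjecture.exteriorOf 𝒟.toCauchyDevelopment d'.charted ∧ Summit.FinalStateConjecture.RaysStayInClosure 𝒟.toCauchyDevelopment O' ∧ Summit.FinalStateConjecture.HasExhaustiveCharts d' ∧ Summit.FinalStateConjecture.IsFutureOriented d') :=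
  Summit.FinalStateConjecture.FinalStateConjecture.Theorems.concl_of_era_dispersal

end Summit.FinalStateConjecture.FinalStateConjecture.Cruxes.DyadicCapture.Birth

end
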